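import Summits.QuantumFields.YangMills.Theorems.SwapVirialDeficitZeroModeGroupConeRadial
import Mathlib.MeasureTheory.Measure.Lebesgue.EqHaar
import HarnessLib

/-!
# Route `SwapVirialDeficit` (YangMills): THE CONE MEASURE IN CARTESIAN HUB LETTERS `a = r(1 + h)`, `h ∈ ℝ³` — the disintegration for the tip ACROSS the apex
# (cell ym-idea-1, skeleton ➎, brick P1 of w2 g60's memo2 `w2-g60-memo2-24197-tip-currency.md` for `stub_core_tip` — plan of record per LEAD g99 2026-08-31T22:48Z;
# free-hands support of ⟨stmt-QuantumFields-24197⟩ `SwapVirialDeficit.SwapGluedStiffness`)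

The polar hub letter `δ = re a∕‖im a‖` of ✓`lintegral_coneMeasure_hubCot` collapses the direction `ω = im a∕‖im a‖` and makes the apex `im a = 0` a fake singularity
(`1∕sin²ψ`).  Here the three Cartesian letters `h = im a ∕ re a ∈ ℝ³` are kept:
* ★★ `lintegral_coneMeasure_hubCart` — for every measurable `Φ : ℍ → ℝ≥0∞`,
  `∫ Φ dcone = coneConst·∫_{r ∈ ℝ} |r|³·∫_{h ∈ ℝ³} 𝟙{r²(1 + |h|²) < 1}·Φ(r·(1 + h)) dh dr`
  (✓`measurePreserving_quatReImEquiv`, Tonelli, and the linear scaling `v = r·h` of Lebesgue measure on `ℝ³`, Mathlib `Measure.map_addHaar_smul`; the line `r = 0` is null).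
Near the apex the weight is the smooth `|r|³ dr d³h` — no `sin²ψ`, no orbit collapse: the starting point of the two-sided fibred Laplace step across `ψ = 0` (memo2 P1–P8).

HONEST LABEL: finite-dimensional measure theory; `stub_core_tip` and the other stubs, ⟨24197⟩ ∕ ⟨24194⟩ OPEN; own crux ⟨22884⟩ `LargeFieldMassRefinementTail` OPEN (blocked-on ⟨19935⟩);
the Yang–Mills mass gap is NOT proved; no summit is proved by a line.  THEOREMS ONLY (0 `def`, 0 `sorry`), standard axioms; the route's local `ℍ` measurability instances
(as in ✓`…ConeRadial`).  Width seat ym-line-sfw-p2-w2 g60 (cell ym-idea-1, free hands), `--supports stmt-QuantumFields-24197`.  References: [folklore].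
-/

set_option autoImplicit false

noncomputable section

open MeasureTheory Quaternion Set Module
open scoped Quaternion ENNReal BigOperators
open Literature.MathematicalPhysics.QuantumLattice
open Summit.QuantumFields.YangMills.Theorems.SwapTwistDeficit.ToronLog

attribute [local instance] Literature.Analysis.FluidPDE.Tao2016.quatMeasurableSpace
  Literature.Analysis.FluidPDE.Tao2016.quatBorelSpace

namespace Summit.QuantumFields.YangMills.Theorems.SwapVirialDeficit.SectorLaplace

open Summit.QuantumFields.YangMills.Theorems.SwapVirialDeficit.ZeroModeGroup

/-- The hub with Cartesian letters `(r, h)`: `quatReImEquiv.symm (r, r • h) = r·(1 + h)` read componentwise — `re = r`, `im = r·h`. [folklore] -/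
theorem quatReImEquiv_symm_smul (r : ℝ) (h : Fin 3 → ℝ) :
    (quatReImEquiv.symm (r, r • h)).re = r ∧ (quatReImEquiv.symm (r, r • h)).imI = r * h 0 ∧
      (quatReImEquiv.symm (r, r • h)).imJ = r * h 1 ∧ (quatReImEquiv.symm (r, r • h)).imK = r * h 2 := by
  rw [quatReImEquiv_symm_apply]
  simp

/-- ★ **LINEAR SCALING ON `ℝ³`**: for `r ≠ 0` and measurable `G ≥ 0`, `∫ G(v) dv = |r|³·∫ G(r·h) dh` (Mathlib `Measure.map_addHaar_smul`). [folklore] -/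
theorem lintegral_comp_smul_fin3 {r : ℝ} (hr : r ≠ 0) (G : (Fin 3 → ℝ) → ℝ≥0∞) (hG : Measurable G) :
    ∫⁻ v : Fin 3 → ℝ, G v = ENNReal.ofReal (|r| ^ 3) * ∫⁻ h : Fin 3 → ℝ, G (r • h) := by
  have hmap := Measure.map_addHaar_smul (volume : Measure (Fin 3 → ℝ)) hr
  rw [finrank_fintype_fun_eq_card, Fintype.card_fin] at hmap
  have hms : Measurable fun h : Fin 3 → ℝ => r • h := measurable_const_smul r
  have h1 : ∫⁻ h : Fin 3 → ℝ, G (r • h) = ∫⁻ v, G v ∂(Measure.map (fun h : Fin 3 → ℝ => r • h) volume) := by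
    rw [lintegral_map hG hms]
  rw [h1, hmap, lintegral_smul_measure, smul_eq_mul, ← mul_assoc, ← ENNReal.ofReal_mul (by positivity)]
  have hr3 : |r| ^ 3 * |(r ^ 3)⁻¹| = 1 := by
    rw [abs_inv, abs_pow, mul_inv_cancel₀ (pow_ne_zero 3 (abs_ne_zero.2 hr))]
  rw [hr3, ENNReal.ofReal_one, one_mul]

/-- ★★ **THE CONE MEASURE IN CARTESIAN HUB LETTERS**: for every measurable `Φ : ℍ → ℝ≥0∞`,
`∫ Φ dcone = coneConst·∫_{r} |r|³·∫_{h ∈ ℝ³} 𝟙{r²(1+|h|²) < 1}·Φ(quatReImEquiv.symm (r, r • h)) dh dr` — the hub `a = r(1 + h)`, smooth weight `|r|³ dr d³h` through the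
apex `h = 0`. [folklore] -/
theorem lintegral_coneMeasure_hubCart (Φ : ℍ → ℝ≥0∞) (hΦ : Measurable Φ) :
    ∫⁻ a, Φ a ∂coneMeasure =
      ENNReal.ofReal coneConst * ∫⁻ r : ℝ, ENNReal.ofReal (|r| ^ 3) *
        ∫⁻ h : Fin 3 → ℝ, {q : ℝ × (Fin 3 → ℝ) | q.1 ^ 2 * (1 + ∑ i, q.2 i ^ 2) < 1}.indicator (fun q => Φ (quatReImEquiv.symm (q.1, q.1 • q.2))) (r, h) := by
  rw [lintegral_coneMeasure_eq]
  congr 1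
  -- through `quatReImEquiv` and Tonelli
  set Ψ : ℝ × (Fin 3 → ℝ) → ℝ≥0∞ := fun q => (Metric.ball (0 : ℍ) 1).indicator Φ (quatReImEquiv.symm q) with hΨ
  have hΨm : Measurable Ψ := (hΦ.indicator measurableSet_ball).comp quatReImEquiv.symm.measurable
  have e : (fun a : ℍ => (Metric.ball (0 : ℍ) 1).indicator Φ a) = fun a => Ψ (quatReImEquiv a) := funext fun a => by
    rw [hΨ]; simp only [MeasurableEquiv.symm_apply_apply]
  rw [e, measurePreserving_quatReImEquiv.lintegral_comp hΨm,
    show (volume : Measure (ℝ × (Fin 3 → ℝ))) = (volume : Measure ℝ).prod (volume : Measure (Fin 3 → ℝ)) from rfl, lintegral_prod _ hΨm.aemeasurable]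
  -- the line `r = 0` is null: work with `r ≠ 0` almost everywhere
  have hae : ∀ᵐ r : ℝ ∂volume, r ≠ 0 := by
    have h : (volume : Measure ℝ) {0} = 0 := measure_singleton 0
    filter_upwards [measure_eq_zero_iff_ae_notMem.1 h] with r hr
    simpa using hr
  refine lintegral_congr_ae (hae.mono fun r hr => ?_)
  -- scale `v = r • h`
  have hΨr : Measurable fun v : Fin 3 → ℝ => Ψ (r, v) := hΨm.comp measurable_prodMk_left
  show ∫⁻ v : Fin 3 → ℝ, Ψ (r, v) = ENNReal.ofReal (|r| ^ 3) * _
  rw [lintegral_comp_smul_fin3 hr (fun v => Ψ (r, v)) hΨr]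
  congr 1
  refine lintegral_congr fun h => ?_
  -- the ball in the letters `(r, h)`: `‖r(1+h)‖² = r²(1 + |h|²)`
  have hnorm : ‖quatReImEquiv.symm (r, r • h)‖ ^ 2 = r ^ 2 * (1 + ∑ i, h i ^ 2) := by
    obtain ⟨e0, e1, e2, e3⟩ := quatReImEquiv_symm_smul r h
    rw [sq, ← Quaternion.normSq_eq_norm_mul_self, Quaternion.normSq_def', e0, e1, e2, e3, Fin.sum_univ_three]; ring
  have hmem : quatReImEquiv.symm (r, r • h) ∈ Metric.ball (0 : ℍ) 1 ↔ (r, h) ∈ {q : ℝ × (Fin 3 → ℝ) | q.1 ^ 2 * (1 + ∑ i, q.2 i ^ 2) < 1} := by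
    rw [Metric.mem_ball, dist_zero_right, mem_setOf_eq, ← hnorm]
    constructor
    · intro hlt; nlinarith [norm_nonneg (quatReImEquiv.symm (r, r • h))]
    · intro hlt
      have h0 := norm_nonneg (quatReImEquiv.symm (r, r • h))
      nlinarith [h0]
  show (Metric.ball (0 : ℍ) 1).indicator Φ (quatReImEquiv.symm (r, r • h)) = _
  by_cases hb : quatReImEquiv.symm (r, r • h) ∈ Metric.ball (0 : ℍ) 1
  · rw [indicator_of_mem hb, indicator_of_mem (hmem.1 hb)]
  · rw [indicator_of_notMem hb, indicator_of_notMem (fun h' => hb (hmem.2 h'))]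

end Summit.QuantumFields.YangMills.Theorems.SwapVirialDeficit.SectorLaplace

end
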